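import Summits.HodgeConjecture.HodgeConjecture.Theorems.F0P6aStubRHO1Rho1Rows
import HarnessLib

/-!
# `F0P6aStubRHO1Rho1Dock` — ★ RE-HOME of `Lines/F0_P6a_StubRHO1.lean` (tree sha16 ce86702e556aed39, 1561 l.), PART 5 of 6 — tree lines :1198–:1471
See PART 1 `Theorems/F0P6aStubRHO1K4Seam.lean` for the full ★ re-home header and the original module docstring (verbatim there).  Same namespace (every
fully-qualified name unchanged); the scopes open at the cut are re-opened below with their `variable` ∕ `open` ∕ `set_option` ∕ `universe` lines replayed verbatim
from the tree, in order; the code after the replay block is the tree bytes :1198–:1471, untouched except the (d1) cure named in PART 1.  HC_CM is proved only modulo the 7 printed citations (2 remaining: hLiu418 = stmt-HodgeConjecture-24832, h413 = stmt-HodgeConjecture-24833) until rung 0 closes; a re-home is count-neutral.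
-/

-- ── replay of the scopes open at tree line :1198 (verbatim) ──
set_option autoImplicit false
set_option linter.dupNamespace false
noncomputable section
namespace Summit.HodgeConjecture.HodgeConjecture.Cruxes.HLiu418.F0P6aLineSpecialisation
open CategoryTheory CategoryTheory.Limits NumberField IsDedekindDomain MulAction AlgebraicGeometry
open scoped Matrix Polynomial Pointwise MonoidalCategory
open Literature.NumberTheory.GaloisRepresentations
open Literature.NumberTheory.Automorphic Literature.NumberTheory.Automorphic.UnitaryGroup
open Literature.AlgebraicGeometry.ShimuraVarieties.UnitaryCanonicalModel
open Literature.NumberTheory.Automorphic.Liu2021.AppendixC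
open Literature.AlgebraicGeometry.Motives (AlgPoints IntegralModel SchemeOver thickening thickeningGalAction thickeningLift specOver extendPoint
  specValuationSubring specFractionFieldι specRingHomι)
open Literature.NumberTheory.EllipticCurves (genericFibre specGenericPoint)
open Literature.NumberTheory.DiophantineGeometry (geomResidueField specialFibreFunctor specResidueField geomClosedPointIsoSpecResidueField
  toClosureValuationSubring)
open Literature.AlgebraicGeometry.RelativeSpec (ActionOver)
open Literature.AlgebraicGeometry.AbelianSchemes Literature.AlgebraicGeometry.AbelianSchemes.AbelianSchemeOver
open Literature.AlgebraicGeometry.GroupSchemes.AffineGroupScheme (Alg quotIncl)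
open Summit.HodgeConjecture.HodgeConjecture.Cruxes.HLiu418.F0P6aModuliDatumDefs
open Summit.HodgeConjecture.HodgeConjecture.Cruxes.HLiu418.F0P6aRGDAssembly
open Summit.HodgeConjecture.HodgeConjecture.Cruxes.HLiu418.F0P6aDatumOfInputs
section Rho1Head
open scoped MonObj CategoryTheory.Obj
variable {F : Type} [Field F] [NumberField F] [IsCMField F] [IsGalois ℚ F] {ι₁ : F →+* ℂ}
    {Jstar : Matrix (Fin 2) (Fin 2) F}
    {K₀ : C5.OpenCompactSubgroup ↥(finAdelic ↥(maximalRealSubfield F) F (IsCMField.complexConj F) 2 Jstar)}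
    {S : RecordSystemGS F Jstar ι₁ K₀} {hU7ₛ : S.HeckeTranslateDefinedOver}
    {hJ : (Jstar.map (IsCMField.complexConj F))ᵀ = Jstar} {hJu : IsUnit Jstar}
    {Fi : Type} [Field Fi] [Algebra F Fi] {Kc : C5.SmallLevel K₀} {G : Type} [Group G]
    {𝓜 : IntegralModel (𝓞 F) F ((thickening F Fi).obj (S.M.obj Kc))}
    {w : HeightOneSpectrum (𝓞 F)} {hw : (IsCMField.complexConj F) • w ≠ w} {h𝓨 : (𝓜.localise w).IsSmoothProper 1}
    {θ : ActionOver (𝓜.localise w).total.hom ((Fi ≃ₐ[F] Fi) × G)}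
    {e : Fi →ₐ[F] AlgebraicClosure (w.adicCompletion F)}
set_option backward.isDefEq.respectTransparency false
set_option linter.unusedSectionVars false

set_option maxHeartbeats 400000 in
set_option backward.isDefEq.respectTransparency false in
/-- **(ρ1𝒞) v6 §J ROW (DOCK) IN BINDER FORM** (v5 hole 3∕4; binders pruned): the socket's (DOCK) conjunct at `ψ := qb` from the leg's (r4₀)(K3₀)(K2₀)(FIN₀)(RK₀) rows and `IsMonHom` — `dock_row_of_legs_sigma` (RKC → §K4 → (KE) → (KEW) → W7 §7) with the (F1) pins. [cite: Liu2021, Prop. D.8 (3) p. 135, pp. 136–138] [cite: SerreTate1968, §1 Lemma 2] [cite: Tate1997FiniteFlatGroupSchemes, (3.7)] -/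
theorem rho1_rowDOCK_of_leg (I : RGDInputsAt F ι₁ Jstar K₀ S hU7ₛ hJ hJu Fi Kc G 𝓜 w hw h𝓨 θ e)
    [ExpChar (geomResidueField w) I.pChar]
    (𝔡 : ∀ xbar, DockAt I xbar)
    (quotΩ : ∀ y, LineOf I y → AlgPoints (S.M.obj Kc) (AlgebraicClosure (w.adicCompletion F)))
    (translΩ : AlgPoints (S.M.obj Kc) (AlgebraicClosure (w.adicCompletion F)) → AlgPoints (S.M.obj Kc) (AlgebraicClosure (w.adicCompletion F)))
    (_hhecke : HeckeClause I quotΩ translΩ)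
    (_hroof : RoofLink I quotΩ)
    (_hroof₂ : RoofLink₂ I translΩ)
    (_hunit : (UnitaryGroup.isUnit_placeForm Jstar hJu w).unit ∈ glInt 2 (w.adicCompletion F))
    (_hKc : UnitaryGroup.IsHyperspecialAt ↥(maximalRealSubfield F) F (IsCMField.complexConj F) 2 Jstar Kc.1.1
      (w.under (𝓞 ↥(maximalRealSubfield F))))
    {m : ℕ}
    (E' : Matrix (Fin m) (Fin m) (𝓞 F))
    (hE' : E' * E' = E')
    (y : AlgPoints (S.M.obj Kc) (AlgebraicClosure (w.adicCompletion F)))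
    (L : LineOf I y)
    (K : Subgroup ((fibreΩOf S Kc 𝓜 w e I.univ y).Points (AlgebraicClosure (w.adicCompletion F))))
    (_hKL : ∀ P, P ∈ L.1 ↔ P ∈ K ∧ IsIdealTorsionΩ S Kc 𝓜 w e I.univ I.act y ((IsCMField.complexConj F) • w).asIdeal P)
    (hRoof : RoofΩ S Kc 𝓜 w e I.univ I.act I.dual I.pol I.lvl I.pChar w.asIdeal y (quotΩ y L) K)
    {B : AbelianSchemeOver (Spec (CommRingCat.of (AlgebraicClosure (w.adicCompletion F))))}
    (q : (schΩOf S Kc 𝓜 w e I.univ y).X ⟶ B.X)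
    [IsMonHom q]
    (_hr1 : ∀ P : (fibreΩOf S Kc 𝓜 w e I.univ y).Points (AlgebraicClosure (w.adicCompletion F)),
        (AlgPoints.map q P : B.toAffine.toAbelianVariety.Points (AlgebraicClosure (w.adicCompletion F))) = 1 ↔ P ∈ K)
    -- the reduced leg under TWO names tied by `hq`: `qbR` at ④-bis's RAW carrier (the row BINDERS below read it in ④-bis's own text — syntactic
    -- against `H.choose_spec`), `qb` at the SOCKET carrier (the conclusion reads it — syntactic against the socket); LA2-plan (g2) (L1)(L3)
    (qbR : haveI := I.comm; haveI : IsProper (𝓜.localise w).total.hom := h𝓨.2;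
      ((I.univ.baseChange (pullback.fst (𝓜.localise w).total.hom (specResidueField w))).baseChange ((𝓜.localise w).geomReductionMap (thickeningLift e (S.M.obj Kc) y)).left).X ⟶
        (((serreTensor I.act E' hE').baseChange (pullback.fst (𝓜.localise w).total.hom (specResidueField w))).baseChange ((𝓜.localise w).geomReductionMap (thickeningLift e (S.M.obj Kc) (quotΩ y L))).left).X)
    (qb : haveI := I.comm; (sch₀Of 𝓜 w I.univ (red₀Of S Kc 𝓜 w h𝓨 e y)).X ⟶ (sch₀Of 𝓜 w (serreTensor I.act E' hE') (red₀Of S Kc 𝓜 w h𝓨 e (quotΩ y L))).X)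
    (hq : haveI := I.comm; qb = qbR)
    (hm : haveI := I.comm; haveI : IsProper (𝓜.localise w).total.hom := h𝓨.2; IsMonHom qbR)
    (hACT : haveI := I.comm; haveI : IsProper (𝓜.localise w).total.hom := h𝓨.2;
      (∀ a : 𝓞 F, ((I.act.baseChange (pullback.fst (𝓜.localise w).total.hom (specResidueField w))).baseChange ((𝓜.localise w).geomReductionMap (thickeningLift e (S.M.obj Kc) y)).left).i a ≫ qbR =
          qbR ≫ (((serreAction I.act E' hE').baseChange (pullback.fst (𝓜.localise w).total.hom (specResidueField w))).baseChange ((𝓜.localise w).geomReductionMap (thickeningLift e (S.M.obj Kc) (quotΩ y L))).left).i a))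
    (hK3 : haveI := I.comm; haveI : IsProper (𝓜.localise w).total.hom := h𝓨.2;
      (∀ (𝒦 : Over (Spec (.of (closureValuationSubring (w.adicCompletion F))))) (incl : 𝒦 ⟶ (I.univ.baseChange (extendPoint (closureValuationSubring (w.adicCompletion F)) (toClosureValuationSubring w) (𝓜.localise w).total ((𝓜.localise w).modelPointsEquiv.symm (thickeningLift e (S.M.obj Kc) y))).left).X) [Flat 𝒦.hom],
          ((Over.pullback (specFractionFieldι (closureValuationSubring (w.adicCompletion F)) (toClosureValuationSubring w)).left).map incl ≫
              (I.univ.fibreBaseChangeIso ((𝓜.localise w).genericIso'.inv.left ≫ pullback.fst (𝓜.localise w).total.hom (specGenericPoint (HeightOneSpectrum.valuationSubringAtPrime F w) F)) (thickeningLift e (S.M.obj Kc) y).left ≪≫ I.univ.fibreCongrPtIso ((𝓜.localise w).left_specFractionFieldι_comp_extendPoint_modelPointsEquiv_symm (thickeningLift e (S.M.obj Kc) y)).symm ≪≫ (I.univ.fibreBaseChangeIso (extendPoint (closureValuationSubring (w.adicCompletion F)) (toClosureValuationSubring w) (𝓜.localise w).total ((𝓜.localise w).modelPointsEquiv.symm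 (thickeningLift e (S.M.obj Kc) y))).left (specFractionFieldι (closureValuationSubring (w.adicCompletion F)) (toClosureValuationSubring w)).left).symm).inv.hom.hom.hom) ≫ q = 1 →
          ((Over.pullback ((geomClosedPointIsoSpecResidueField w).inv.left ≫ (specRingHomι (closureValuationSubring (w.adicCompletion F)) (toClosureValuationSubring w) (IsLocalRing.residue (closureValuationSubring (w.adicCompletion F)))).left)).map incl ≫
              (I.univ.fibreBaseChangeIso (pullback.fst (𝓜.localise w).total.hom (specResidueField w)) ((𝓜.localise w).geomReductionMap (thickeningLift e (S.M.obj Kc) y)).left ≪≫ I.univ.fibreCongrPtIso (((𝓜.localise w).left_geomReductionMap_comp_fst (thickeningLift e (S.M.obj Kc) y)).trans (Category.assoc _ _ _).symm) ≪≫ (I.univ.fibreBaseChangeIso (extendPoint (closureValuationSubring (w.adicCompletion F)) (toClosureValuationSubring w) (𝓜.localise w).total ((𝓜.localise w).modelPointsEquiv.symm (thickeningLift e (S.M.obj Kc) y))).left ((geomClosedPointIsoSpecResidueField w).inv.left ≫ (specRingHomι (closureValuationSubring (w.adicCompletion F)) (toClosureValuationSubring w) (IsLocalRing.residue (closureValuationSubring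 (w.adicCompletion F)))).left)).symm).inv.hom.hom.hom) ≫ qbR = 1))
    (hK2 : haveI := I.comm; haveI : IsProper (𝓜.localise w).total.hom := h𝓨.2;
      (∀ 𝔞 : Ideal (𝓞 F),
          (∀ Pt : ((I.univ.baseChange ((𝓜.localise w).genericIso'.inv.left ≫ pullback.fst (𝓜.localise w).total.hom (specGenericPoint (HeightOneSpectrum.valuationSubringAtPrime F w) F))).baseChange
              (thickeningLift e (S.M.obj Kc) y).left).toAffine.toAbelianVariety.Points (AlgebraicClosure (w.adicCompletion F)),
            (AlgPoints.map q Pt : B.toAffine.toAbelianVariety.Points (AlgebraicClosure (w.adicCompletion F))) = 1 →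
              ∀ r ∈ 𝔞, (AlgPoints.map (((I.act.baseChange ((𝓜.localise w).genericIso'.inv.left ≫ pullback.fst (𝓜.localise w).total.hom (specGenericPoint (HeightOneSpectrum.valuationSubringAtPrime F w) F))).baseChange (thickeningLift e (S.M.obj Kc) y).left).i r) Pt :
                ((I.univ.baseChange ((𝓜.localise w).genericIso'.inv.left ≫ pullback.fst (𝓜.localise w).total.hom (specGenericPoint (HeightOneSpectrum.valuationSubringAtPrime F w) F))).baseChange
                  (thickeningLift e (S.M.obj Kc) y).left).toAffine.toAbelianVariety.Points (AlgebraicClosure (w.adicCompletion F))) = 1) →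
          ∀ ⦃T : Over (Spec (.of (geomResidueField w)))⦄ (z : T ⟶ ((I.univ.baseChange (pullback.fst (𝓜.localise w).total.hom (specResidueField w))).baseChange ((𝓜.localise w).geomReductionMap (thickeningLift e (S.M.obj Kc) y)).left).X),
            z ≫ qbR = 1 → ∀ r ∈ 𝔞, z ≫ ((I.act.baseChange (pullback.fst (𝓜.localise w).total.hom (specResidueField w))).baseChange ((𝓜.localise w).geomReductionMap (thickeningLift e (S.M.obj Kc) y)).left).i r = 1))
    (hFIN : haveI := I.comm; haveI : IsProper (𝓜.localise w).total.hom := h𝓨.2;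
      IsFinite qbR.left)
    (hRK : haveI := I.comm; haveI : IsProper (𝓜.localise w).total.hom := h𝓨.2;
      Module.finrank (geomResidueField w) (Literature.AlgebraicGeometry.GroupSchemes.AffineGroupScheme.Alg (Literature.AlgebraicGeometry.GroupSchemes.GroupSchemeKernel.ker qbR)) =
          Nat.card (Literature.AlgebraicGeometry.Motives.AbelianVariety.Hom.kerPoints (specOver (AlgebraicClosure (w.adicCompletion F)) (AlgebraicClosure (w.adicCompletion F))) (homOfIsMonHom q))) :
    haveI := I.comm;
    letI := (𝔡 (red₀Of S Kc 𝓜 w h𝓨 e y)).grp₀;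
    haveI := (𝔡 (red₀Of S Kc 𝓜 w h𝓨 e y)).aff₀;
      (∀ ⦃T : SchemeOver (geomResidueField w)⦄ (t : T ⟶ (𝔡 (red₀Of S Kc 𝓜 w h𝓨 e y)).G₀),
          t ≫ (𝔡 (red₀Of S Kc 𝓜 w h𝓨 e y)).ι₀G ≫ qb = 1 ↔
            ∃ s : T ⟶ specOver (geomResidueField w) (Alg (𝔡 (red₀Of S Kc 𝓜 w h𝓨 e y)).G₀ ⧸ (spGeoOf I 𝔡 y L).1),
              s ≫ quotIncl (𝔡 (red₀Of S Kc 𝓜 w h𝓨 e y)).G₀ (spGeoOf I 𝔡 y L).1 = t) := by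
  haveI := I.comm
  haveI : IsProper (𝓜.localise w).total.hom := h𝓨.2
  letI := (𝔡 (red₀Of S Kc 𝓜 w h𝓨 e y)).grp₀
  haveI := (𝔡 (red₀Of S Kc 𝓜 w h𝓨 e y)).aff₀
  subst hq
  have hσ := sigma_pins I y
  exact dock_row_of_legs_sigma I 𝔡 quotΩ translΩ _hhecke _hroof _hroof₂ _hunit _hKc E' hE' y L K _hKL hRoof q _hr1 qb hm hσ.1 hσ.2
    hACT hK3 hK2 hFIN hRK

set_option maxHeartbeats 400000 in
set_option backward.isDefEq.respectTransparency false in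
/-- **(ρ1𝒞) v6 §J ROW (IMG) IN BINDER FORM** (v5 hole 4∕4; binders = the roof's (r1)–(r5) in D-line currency for § Jφ): the socket's (IMG) conjunct at `ψ := qb` from the leg's (IMG-gen) row — served § IMG `row_IMG` over § Jφ `imgLine_quotΩ_quotΩ_eq_translΩ_assembled` (PART C; `hpN` := LS `coprime_pChar_N_of_specialPoint` at `red₀Of … y` with `0 < g` from `I.hg`; `hunr := I.hunr`; membership via `mem_imgLineOfRoof_iff`). [cite: Liu2021, Prop. D.8 (3) p. 135, pp. 136–138] [cite: SerreTate1968, §1 Lemma 2] -/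
theorem rho1_rowIMG_of_leg (I : RGDInputsAt F ι₁ Jstar K₀ S hU7ₛ hJ hJu Fi Kc G 𝓜 w hw h𝓨 θ e)
    [ExpChar (geomResidueField w) I.pChar]
    (𝔡 : ∀ xbar, DockAt I xbar)
    (quotΩ : ∀ y, LineOf I y → AlgPoints (S.M.obj Kc) (AlgebraicClosure (w.adicCompletion F)))
    (translΩ : AlgPoints (S.M.obj Kc) (AlgebraicClosure (w.adicCompletion F)) → AlgPoints (S.M.obj Kc) (AlgebraicClosure (w.adicCompletion F)))
    (_hhecke : HeckeClause I quotΩ translΩ)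
    (_hroof : RoofLink I quotΩ)
    (_hroof₂ : RoofLink₂ I translΩ)
    (_hunit : (UnitaryGroup.isUnit_placeForm Jstar hJu w).unit ∈ glInt 2 (w.adicCompletion F))
    (_hKc : UnitaryGroup.IsHyperspecialAt ↥(maximalRealSubfield F) F (IsCMField.complexConj F) 2 Jstar Kc.1.1
      (w.under (𝓞 ↥(maximalRealSubfield F))))
    {m : ℕ}
    (E' : Matrix (Fin m) (Fin m) (𝓞 F))
    (hE' : E' * E' = E')
    (P : Matrix (Fin m) (Fin 1) (𝓞 F))
    (Q : Matrix (Fin 1) (Fin m) (𝓞 F))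
    (_hP : E' * P = P)
    (_hQ : Q * E' = Q)
    (_hQP : Q * P = Matrix.scalar (Fin 1) (I.pChar : 𝓞 F))
    (_hPQ : P * Q = Matrix.scalar (Fin m) (I.pChar : 𝓞 F) * E')
    (_h𝔭 : Ideal.span (Set.range fun k => P k 0) = w.asIdeal)
    (y : AlgPoints (S.M.obj Kc) (AlgebraicClosure (w.adicCompletion F)))
    (L : LineOf I y)
    (K : Subgroup ((fibreΩOf S Kc 𝓜 w e I.univ y).Points (AlgebraicClosure (w.adicCompletion F))))
    (_hKL : ∀ P, P ∈ L.1 ↔ P ∈ K ∧ IsIdealTorsionΩ S Kc 𝓜 w e I.univ I.act y ((IsCMField.complexConj F) • w).asIdeal P)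
    {B : AbelianSchemeOver (Spec (CommRingCat.of (AlgebraicClosure (w.adicCompletion F))))}
    (DB : B.DualPair)
    (lamB : B.X ⟶ DB.hat.X)
    [IsMonHom lamB]
    (hDBu : Nonempty ((Scheme.Modules.pullback DB.unitHatSlice).obj DB.P ≅ SheafOfModules.unit _))
    (q : (schΩOf S Kc 𝓜 w e I.univ y).X ⟶ B.X)
    [IsMonHom q]
    (c : (schΩOf S Kc 𝓜 w e I.univ (quotΩ y L)).X ⟶ B.X)
    [IsMonHom c]
    (_hr1 : ∀ P : (fibreΩOf S Kc 𝓜 w e I.univ y).Points (AlgebraicClosure (w.adicCompletion F)),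
        (AlgPoints.map q P : B.toAffine.toAbelianVariety.Points (AlgebraicClosure (w.adicCompletion F))) = 1 ↔ P ∈ K)
    (hr2 : ∀ P : (fibreΩOf S Kc 𝓜 w e I.univ (quotΩ y L)).Points (AlgebraicClosure (w.adicCompletion F)),
        (AlgPoints.map c P : B.toAffine.toAbelianVariety.Points (AlgebraicClosure (w.adicCompletion F))) = 1 ↔
          IsIdealTorsionΩ S Kc 𝓜 w e I.univ I.act (quotΩ y L) w.asIdeal P)
    (hcsurj : Function.Surjective c.left.base)
    (hr3q : q ≫ lamB ≫ DualPair.dualIsogenyOver q (dualΩOf S Kc 𝓜 w e I.univ I.dual y) DB =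
      (polΩOf S Kc 𝓜 w e I.univ I.pol y).lam ≫ (dualΩOf S Kc 𝓜 w e I.univ I.dual y).hat.mulN I.pChar)
    (hr3c : c ≫ lamB ≫ DualPair.dualIsogenyOver c (dualΩOf S Kc 𝓜 w e I.univ I.dual (quotΩ y L)) DB =
      (polΩOf S Kc 𝓜 w e I.univ I.pol (quotΩ y L)).lam ≫ (dualΩOf S Kc 𝓜 w e I.univ I.dual (quotΩ y L)).hat.mulN I.pChar)
    (hr4 : ∀ a : 𝓞 F, ∃ b : B.X ⟶ B.X,
      (actΩOf S Kc 𝓜 w e I.univ I.act a y).hom.hom.hom ≫ q = q ≫ b ∧ (actΩOf S Kc 𝓜 w e I.univ I.act a (quotΩ y L)).hom.hom.hom ≫ c = c ≫ b)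
    (hr5 : ∀ a : Fin I.g ⊕ Fin I.g → ZMod I.N,
      (AlgPoints.map q (lvlPtΩOf S Kc 𝓜 w e I.univ I.lvl y a) : B.toAffine.toAbelianVariety.Points (AlgebraicClosure (w.adicCompletion F))) =
        AlgPoints.map c (lvlPtΩOf S Kc 𝓜 w e I.univ I.lvl (quotΩ y L) a))
    -- the reduced leg under TWO names tied by `hq`: `qbR` at ④-bis's RAW carrier (the row BINDERS below read it in ④-bis's own text — syntactic
    -- against `H.choose_spec`), `qb` at the SOCKET carrier (the conclusion reads it — syntactic against the socket); LA2-plan (g2) (L1)(L3)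
    (qbR : haveI := I.comm; haveI : IsProper (𝓜.localise w).total.hom := h𝓨.2;
      ((I.univ.baseChange (pullback.fst (𝓜.localise w).total.hom (specResidueField w))).baseChange ((𝓜.localise w).geomReductionMap (thickeningLift e (S.M.obj Kc) y)).left).X ⟶
        (((serreTensor I.act E' hE').baseChange (pullback.fst (𝓜.localise w).total.hom (specResidueField w))).baseChange ((𝓜.localise w).geomReductionMap (thickeningLift e (S.M.obj Kc) (quotΩ y L))).left).X)
    (qb : haveI := I.comm; (sch₀Of 𝓜 w I.univ (red₀Of S Kc 𝓜 w h𝓨 e y)).X ⟶ (sch₀Of 𝓜 w (serreTensor I.act E' hE') (red₀Of S Kc 𝓜 w h𝓨 e (quotΩ y L))).X)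
    (hq : haveI := I.comm; qb = qbR)
    (hIMG : haveI := I.comm; haveI : IsProper (𝓜.localise w).total.hom := h𝓨.2;
      (∀ (𝒦 : Over (Spec (.of (closureValuationSubring (w.adicCompletion F))))) (incl : 𝒦 ⟶ (I.univ.baseChange (extendPoint (closureValuationSubring (w.adicCompletion F)) (toClosureValuationSubring w) (𝓜.localise w).total ((𝓜.localise w).modelPointsEquiv.symm (thickeningLift e (S.M.obj Kc) y))).left).X) [Flat 𝒦.hom]
          (𝒵 : Over (Spec (.of (closureValuationSubring (w.adicCompletion F))))) (ζ : 𝒵 ⟶ (I.univ.baseChange (extendPoint (closureValuationSubring (w.adicCompletion F)) (toClosureValuationSubring w) (𝓜.localise w).total ((𝓜.localise w).modelPointsEquiv.symm (thickeningLift e (S.M.obj Kc) (quotΩ y L)))).left).X) [IsClosedImmersion (ζ ≫ baseChangeHom (serreTranslate I.act E' hE' P) (extendPoint (closureValuationSubring (w.adicCompletion F)) (toClosureValuationSubring w) (𝓜.localise w).total ((𝓜.localise w).modelPointsEquiv.symm (thickeningLift e (S.M.obj Kc) (quotΩ y L)))).left).left],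
          (∃ m : (Over.pullback (specFractionFieldι (closureValuationSubring (w.adicCompletion F)) (toClosureValuationSubring w)).left).obj 𝒦 ⟶ (Over.pullback (specFractionFieldι (closureValuationSubring (w.adicCompletion F)) (toClosureValuationSubring w)).left).obj 𝒵,
            m ≫ (((Over.pullback (specFractionFieldι (closureValuationSubring (w.adicCompletion F)) (toClosureValuationSubring w)).left).map ζ ≫ (I.univ.fibreBaseChangeIso ((𝓜.localise w).genericIso'.inv.left ≫ pullback.fst (𝓜.localise w).total.hom (specGenericPoint (HeightOneSpectrum.valuationSubringAtPrime F w) F)) (thickeningLift e (S.M.obj Kc) (quotΩ y L)).left ≪≫ I.univ.fibreCongrPtIso ((𝓜.localise w).left_specFractionFieldι_comp_extendPoint_modelPointsEquiv_symm (thickeningLift e (S.M.obj Kc) (quotΩ y L))).symm ≪≫ (I.univ.fibreBaseChangeIso (extendPoint (closureValuationSubring (w.adicCompletion F)) (toClosureValuationSubring w) (𝓜.localise w).total ((𝓜.localise w).modelPointsEquiv.symm (thickeningLift e (S.M.obj Kc) (quotΩ y L)))).left (specFractionFieldι (closureValuationSubring (w.adicCompletion F)) (toClosureValuationSubring w)).left).symm).inv.hom.hom.hom)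 ≫ c) =
              ((Over.pullback (specFractionFieldι (closureValuationSubring (w.adicCompletion F)) (toClosureValuationSubring w)).left).map incl ≫ (I.univ.fibreBaseChangeIso ((𝓜.localise w).genericIso'.inv.left ≫ pullback.fst (𝓜.localise w).total.hom (specGenericPoint (HeightOneSpectrum.valuationSubringAtPrime F w) F)) (thickeningLift e (S.M.obj Kc) y).left ≪≫ I.univ.fibreCongrPtIso ((𝓜.localise w).left_specFractionFieldι_comp_extendPoint_modelPointsEquiv_symm (thickeningLift e (S.M.obj Kc) y)).symm ≪≫ (I.univ.fibreBaseChangeIso (extendPoint (closureValuationSubring (w.adicCompletion F)) (toClosureValuationSubring w) (𝓜.localise w).total ((𝓜.localise w).modelPointsEquiv.symm (thickeningLift e (S.M.obj Kc) y))).left (specFractionFieldι (closureValuationSubring (w.adicCompletion F)) (toClosureValuationSubring w)).left).symm).inv.hom.hom.hom) ≫ q) →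
          ∃ m : (Over.pullback ((geomClosedPointIsoSpecResidueField w).inv.left ≫ (specRingHomι (closureValuationSubring (w.adicCompletion F)) (toClosureValuationSubring w) (IsLocalRing.residue (closureValuationSubring (w.adicCompletion F)))).left)).obj 𝒦 ⟶ (Over.pullback ((geomClosedPointIsoSpecResidueField w).inv.left ≫ (specRingHomι (closureValuationSubring (w.adicCompletion F)) (toClosureValuationSubring w) (IsLocalRing.residue (closureValuationSubring (w.adicCompletion F)))).left)).obj 𝒵,
            m ≫ (((Over.pullback ((geomClosedPointIsoSpecResidueField w).inv.left ≫ (specRingHomι (closureValuationSubring (w.adicCompletion F)) (toClosureValuationSubring w) (IsLocalRing.residue (closureValuationSubring (w.adicCompletion F)))).left)).map ζ ≫ (I.univ.fibreBaseChangeIso (pullback.fst (𝓜.localise w).total.hom (specResidueField w)) ((𝓜.localise w).geomReductionMap (thickeningLift e (S.M.obj Kc) (quotΩ y L))).left ≪≫ I.univ.fibreCongrPtIso (((𝓜.localise w).left_geomReductionMap_comp_fst (thickeningLift e (S.M.obj Kc) (quotΩ y L))).trans (Category.assoc _ _ _).symm) ≪≫ (I.univ.fibreBaseChangeIso (extendPoint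 (closureValuationSubring (w.adicCompletion F)) (toClosureValuationSubring w) (𝓜.localise w).total ((𝓜.localise w).modelPointsEquiv.symm (thickeningLift e (S.M.obj Kc) (quotΩ y L)))).left ((geomClosedPointIsoSpecResidueField w).inv.left ≫ (specRingHomι (closureValuationSubring (w.adicCompletion F)) (toClosureValuationSubring w) (IsLocalRing.residue (closureValuationSubring (w.adicCompletion F)))).left)).symm).inv.hom.hom.hom) ≫ baseChangeHom (baseChangeHom (serreTranslate I.act E' hE' P) (pullback.fst (𝓜.localise w).total.hom (specResidueField w))) ((𝓜.localise w).geomReductionMap (thickeningLift e (S.M.obj Kc) (quotΩ y L))).left) =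
              ((Over.pullback ((geomClosedPointIsoSpecResidueField w).inv.left ≫ (specRingHomι (closureValuationSubring (w.adicCompletion F)) (toClosureValuationSubring w) (IsLocalRing.residue (closureValuationSubring (w.adicCompletion F)))).left)).map incl ≫ (I.univ.fibreBaseChangeIso (pullback.fst (𝓜.localise w).total.hom (specResidueField w)) ((𝓜.localise w).geomReductionMap (thickeningLift e (S.M.obj Kc) y)).left ≪≫ I.univ.fibreCongrPtIso (((𝓜.localise w).left_geomReductionMap_comp_fst (thickeningLift e (S.M.obj Kc) y)).trans (Category.assoc _ _ _).symm) ≪≫ (I.univ.fibreBaseChangeIso (extendPoint (closureValuationSubring (w.adicCompletion F)) (toClosureValuationSubring w) (𝓜.localise w).total ((𝓜.localise w).modelPointsEquiv.symm (thickeningLift e (S.M.obj Kc) y))).left ((geomClosedPointIsoSpecResidueField w).inv.left ≫ (specRingHomι (closureValuationSubring (w.adicCompletion F)) (toClosureValuationSubring w) (IsLocalRing.residue (closureValuationSubring (w.adicCompletion F)))).left)).symm).inv.hom.hom.hom) ≫ qbR)) :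
    haveI := I.comm;
    letI := (𝔡 (red₀Of S Kc 𝓜 w h𝓨 e y)).grp₀;
    haveI := (𝔡 (red₀Of S Kc 𝓜 w h𝓨 e y)).aff₀;
      ∃ Lb : LineOf I (quotΩ y L), quotΩ (quotΩ y L) Lb = translΩ y ∧
          (letI := (𝔡 (red₀Of S Kc 𝓜 w h𝓨 e (quotΩ y L))).grp₀; haveI := (𝔡 (red₀Of S Kc 𝓜 w h𝓨 e (quotΩ y L))).aff₀;
            ∀ ⦃T : SchemeOver (geomResidueField w)⦄ (t : T ⟶ (𝔡 (red₀Of S Kc 𝓜 w h𝓨 e y)).G₀),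
              ∃ s : T ⟶ specOver (geomResidueField w) (Alg (𝔡 (red₀Of S Kc 𝓜 w h𝓨 e (quotΩ y L))).G₀ ⧸ (spGeoOf I 𝔡 (quotΩ y L) Lb).1),
                s ≫ quotIncl (𝔡 (red₀Of S Kc 𝓜 w h𝓨 e (quotΩ y L))).G₀ (spGeoOf I 𝔡 (quotΩ y L) Lb).1 ≫ (𝔡 (red₀Of S Kc 𝓜 w h𝓨 e (quotΩ y L))).ι₀G ≫
                    baseChangeHom (baseChangeHom (serreTranslate I.act E' hE' P) (pullback.fst (𝓜.localise w).total.hom (specResidueField w))) (red₀Of S Kc 𝓜 w h𝓨 e (quotΩ y L)).left =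
                  t ≫ (𝔡 (red₀Of S Kc 𝓜 w h𝓨 e y)).ι₀G ≫ qb) := by
  haveI := I.comm
  haveI : IsProper (𝓜.localise w).total.hom := h𝓨.2
  letI := (𝔡 (red₀Of S Kc 𝓜 w h𝓨 e y)).grp₀
  haveI := (𝔡 (red₀Of S Kc 𝓜 w h𝓨 e y)).aff₀
  subst hq
  have hg : 0 < I.g := by rw [I.hg]; exact Module.finrank_pos
  have hpN := coprime_pChar_N_of_specialPoint I (red₀Of S Kc 𝓜 w h𝓨 e y) hg
  have hJφ := imgLine_quotΩ_quotΩ_eq_translΩ_assembled I hpN quotΩ translΩ _hhecke _hunit _hKc _hroof _hroof₂ I.hunr y L K _hKL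
    DB lamB hDBu q c _hr1 hr2 hcsurj hr3q hr3c hr4 hr5
  exact row_IMG I 𝔡 y (quotΩ y L) (fun Lb => quotΩ (quotΩ y L) Lb = translΩ y) q c qb
    (baseChangeHom (baseChangeHom (serreTranslate I.act E' hE' P) (pullback.fst (𝓜.localise w).total.hom (specResidueField w))) (red₀Of S Kc 𝓜 w h𝓨 e (quotΩ y L)).left)
    E' hE' P Q _hP _hQ _hQP _hPQ _h𝔭
    (hJφ.imp fun Lb h => ⟨fun P'' => (h.1 P'').trans (mem_imgLineOfRoof_iff I y (quotΩ y L) q c P''), h.2⟩)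
    hr2 hcsurj hr4 hIMG

set_option maxHeartbeats 400000 in
set_option backward.isDefEq.respectTransparency false in
/-- **(ρ1𝒞) BODY OVER THE DESTRUCTURED ROOF** — the socket conclusion from the roof legs `(K, B, DB, λ_B, q, c, (r1)–(r5))` of `L` (binders = `RoofLink`
clause 1 + `RoofΩ` VERBATIM) and the unit pin `hD`; rows (FLAT-SURJ)(ACT)(LVL)(SIM) folded from §A (b′), the others NAMED `sorry`-rows (census in the head's docstring).
[cite: Liu2021, p. 137] [cite: SerreTate1968, §1 Lemma 2] -/
theorem exists_quotLegReduction_of_legs (I : RGDInputsAt F ι₁ Jstar K₀ S hU7ₛ hJ hJu Fi Kc G 𝓜 w hw h𝓨 θ e) [ExpChar (geomResidueField w) I.pChar]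
    (𝔡 : ∀ xbar, DockAt I xbar)
    -- SOCKET ORDER OF RECORD (LA2-plan (g2) 09:29:54Z (1)): `𝔡 quotΩ translΩ hhecke hroof hroof₂ hunit hKc`, THEN the Serre letters, THEN `(y) (L)`; no `hunr`∕`hpN` head binders
    (quotΩ : ∀ y, LineOf I y → AlgPoints (S.M.obj Kc) (AlgebraicClosure (w.adicCompletion F)))
    (translΩ : AlgPoints (S.M.obj Kc) (AlgebraicClosure (w.adicCompletion F)) → AlgPoints (S.M.obj Kc) (AlgebraicClosure (w.adicCompletion F)))
    (_hhecke : HeckeClause I quotΩ translΩ) (_hroof : RoofLink I quotΩ) (_hroof₂ : RoofLink₂ I translΩ)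
    (_hunit : (UnitaryGroup.isUnit_placeForm Jstar hJu w).unit ∈ glInt 2 (w.adicCompletion F))
    (_hKc : UnitaryGroup.IsHyperspecialAt ↥(maximalRealSubfield F) F (IsCMField.complexConj F) 2 Jstar Kc.1.1
      (w.under (𝓞 ↥(maximalRealSubfield F))))
    {m : ℕ} (E' : Matrix (Fin m) (Fin m) (𝓞 F)) (hE' : E' * E' = E') (P : Matrix (Fin m) (Fin 1) (𝓞 F)) (Q : Matrix (Fin 1) (Fin m) (𝓞 F))
    (_hP : E' * P = P) (_hQ : Q * E' = Q) (_hQP : Q * P = Matrix.scalar (Fin 1) (I.pChar : 𝓞 F))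
    (_hPQ : P * Q = Matrix.scalar (Fin m) (I.pChar : 𝓞 F) * E') (_h𝔭 : Ideal.span (Set.range fun k => P k 0) = w.asIdeal)
    (y : AlgPoints (S.M.obj Kc) (AlgebraicClosure (w.adicCompletion F))) (L : LineOf I y)
    -- the roof of `L`, destructured (binders = `RoofLink` clause 1 + `RoofΩ` rows (r1)–(r5) VERBATIM at `y″ := quotΩ y L`, `𝔞 := w.asIdeal`)
    (hD : Nonempty ((Scheme.Modules.pullback (DualPair.unitHatSlice I.dual)).obj I.dual.P ≅ SheafOfModules.unit _))
    (K : Subgroup ((fibreΩOf S Kc 𝓜 w e I.univ y).Points (AlgebraicClosure (w.adicCompletion F))))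
    (_hKL : ∀ P, P ∈ L.1 ↔ P ∈ K ∧ IsIdealTorsionΩ S Kc 𝓜 w e I.univ I.act y ((IsCMField.complexConj F) • w).asIdeal P)
    -- v5: the roof packaged (the head passes `hK.2`), for RKC's `⟨hKL, hRoof⟩` lemmas
    (hRoof : RoofΩ S Kc 𝓜 w e I.univ I.act I.dual I.pol I.lvl I.pChar w.asIdeal y (quotΩ y L) K)
    {B : AbelianSchemeOver (Spec (CommRingCat.of (AlgebraicClosure (w.adicCompletion F))))}
    (DB : B.DualPair) (lamB : B.X ⟶ DB.hat.X) [IsMonHom lamB]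
    (hDBu : Nonempty ((Scheme.Modules.pullback DB.unitHatSlice).obj DB.P ≅ SheafOfModules.unit _))
    (q : (schΩOf S Kc 𝓜 w e I.univ y).X ⟶ B.X) [IsMonHom q] (c : (schΩOf S Kc 𝓜 w e I.univ (quotΩ y L)).X ⟶ B.X) [IsMonHom c]
    (_hr1 : ∀ P : (fibreΩOf S Kc 𝓜 w e I.univ y).Points (AlgebraicClosure (w.adicCompletion F)),
        (AlgPoints.map q P : B.toAffine.toAbelianVariety.Points (AlgebraicClosure (w.adicCompletion F))) = 1 ↔ P ∈ K)
    (hr2 : ∀ P : (fibreΩOf S Kc 𝓜 w e I.univ (quotΩ y L)).Points (AlgebraicClosure (w.adicCompletion F)),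
        (AlgPoints.map c P : B.toAffine.toAbelianVariety.Points (AlgebraicClosure (w.adicCompletion F))) = 1 ↔
          IsIdealTorsionΩ S Kc 𝓜 w e I.univ I.act (quotΩ y L) w.asIdeal P)
    (hcsurj : Function.Surjective c.left.base)
    (hr3q : q ≫ lamB ≫ DualPair.dualIsogenyOver q (dualΩOf S Kc 𝓜 w e I.univ I.dual y) DB =
      (polΩOf S Kc 𝓜 w e I.univ I.pol y).lam ≫ (dualΩOf S Kc 𝓜 w e I.univ I.dual y).hat.mulN I.pChar)
    (hr3c : c ≫ lamB ≫ DualPair.dualIsogenyOver c (dualΩOf S Kc 𝓜 w e I.univ I.dual (quotΩ y L)) DB =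
      (polΩOf S Kc 𝓜 w e I.univ I.pol (quotΩ y L)).lam ≫ (dualΩOf S Kc 𝓜 w e I.univ I.dual (quotΩ y L)).hat.mulN I.pChar)
    (hr4 : ∀ a : 𝓞 F, ∃ b : B.X ⟶ B.X,
      (actΩOf S Kc 𝓜 w e I.univ I.act a y).hom.hom.hom ≫ q = q ≫ b ∧ (actΩOf S Kc 𝓜 w e I.univ I.act a (quotΩ y L)).hom.hom.hom ≫ c = c ≫ b)
    (hr5 : ∀ a : Fin I.g ⊕ Fin I.g → ZMod I.N,
      (AlgPoints.map q (lvlPtΩOf S Kc 𝓜 w e I.univ I.lvl y a) : B.toAffine.toAbelianVariety.Points (AlgebraicClosure (w.adicCompletion F))) =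
        AlgPoints.map c (lvlPtΩOf S Kc 𝓜 w e I.univ I.lvl (quotΩ y L) a)) :
    haveI := I.comm
    letI := (𝔡 (red₀Of S Kc 𝓜 w h𝓨 e y)).grp₀
    haveI := (𝔡 (red₀Of S Kc 𝓜 w h𝓨 e y)).aff₀
      ∃ (ψ : (sch₀Of 𝓜 w I.univ (red₀Of S Kc 𝓜 w h𝓨 e y)).X ⟶ (sch₀Of 𝓜 w (serreTensor I.act E' hE') (red₀Of S Kc 𝓜 w h𝓨 e (quotΩ y L))).X) (_ : IsMonHom ψ),
        -- (FLAT-SURJ)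
        (Flat ψ.left ∧ Function.Surjective ψ.left.base) ∧
        -- (ACT) `𝒪_F`-equivariance, `act₀Of` currency on both sides (`serreAction` on `𝒞`)
        (∀ a : 𝓞 F, (act₀Of 𝓜 w I.univ I.act a (red₀Of S Kc 𝓜 w h𝓨 e y)).hom.hom.hom ≫ ψ =
          ψ ≫ (act₀Of 𝓜 w (serreTensor I.act E' hE') (serreAction I.act E' hE') a (red₀Of S Kc 𝓜 w h𝓨 e (quotΩ y L))).hom.hom.hom) ∧
        -- (LVL) level points: `ψ(σᵃ(x̄)) = (σᵃ ≫ ψ_P)(x̄″)`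
        (∀ a : Fin I.g ⊕ Fin I.g → ZMod I.N,
          AlgPoints.map ψ (lvlPt₀Of 𝓜 w I.univ I.lvl (red₀Of S Kc 𝓜 w h𝓨 e y) a) =
            ((serreTensor I.act E' hE').baseChange (pullback.fst (𝓜.localise w).total.hom (specResidueField w))).restrictPt (red₀Of S Kc 𝓜 w h𝓨 e (quotΩ y L)).left
              ((serreTensor I.act E' hE').sectionBaseChange (pullback.fst (𝓜.localise w).total.hom (specResidueField w)) (I.lvl.section_ a ≫ serreTranslate I.act E' hE' P))) ∧
        -- (SIM) for EVERY downstairs dual pair of `𝒞_{x̄″}` through which the cover leg pulls back to `λ ≫ [p]`: `ψ^* λ_B̄ = λ_{x̄} ≫ [p]`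
        (∀ (DBs : (sch₀Of 𝓜 w (serreTensor I.act E' hE') (red₀Of S Kc 𝓜 w h𝓨 e (quotΩ y L))).DualPair)
          (_ : Nonempty ((Scheme.Modules.pullback (DualPair.unitHatSlice DBs)).obj DBs.P ≅ SheafOfModules.unit _))
          (lamBs : (sch₀Of 𝓜 w (serreTensor I.act E' hE') (red₀Of S Kc 𝓜 w h𝓨 e (quotΩ y L))).X ⟶ DBs.hat.X) [IsMonHom lamBs],
          (haveI := isMonHom_coverLeg (pullback.fst (𝓜.localise w).total.hom (specResidueField w)) (red₀Of S Kc 𝓜 w h𝓨 e (quotΩ y L)).left I.act E' hE' P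
           baseChangeHom (baseChangeHom (serreTranslate I.act E' hE' P) (pullback.fst (𝓜.localise w).total.hom (specResidueField w))) (red₀Of S Kc 𝓜 w h𝓨 e (quotΩ y L)).left ≫ lamBs ≫
              DualPair.dualIsogenyOver (baseChangeHom (baseChangeHom (serreTranslate I.act E' hE' P) (pullback.fst (𝓜.localise w).total.hom (specResidueField w))) (red₀Of S Kc 𝓜 w h𝓨 e (quotΩ y L)).left)
                (dual₀Of 𝓜 w I.univ I.dual (red₀Of S Kc 𝓜 w h𝓨 e (quotΩ y L))) DBs =
            (pol₀Of 𝓜 w I.univ I.pol (red₀Of S Kc 𝓜 w h𝓨 e (quotΩ y L))).lam ≫ (dual₀Of 𝓜 w I.univ I.dual (red₀Of S Kc 𝓜 w h𝓨 e (quotΩ y L))).hat.mulN I.pChar) →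
          ψ ≫ lamBs ≫ DualPair.dualIsogenyOver ψ (dual₀Of 𝓜 w I.univ I.dual (red₀Of S Kc 𝓜 w h𝓨 e y)) DBs =
            (pol₀Of 𝓜 w I.univ I.pol (red₀Of S Kc 𝓜 w h𝓨 e y)).lam ≫ (dual₀Of 𝓜 w I.univ I.dual (red₀Of S Kc 𝓜 w h𝓨 e y)).hat.mulN I.pChar) ∧
        -- (K2-gen) every ideal bound on the kernel descends: `Ker q(Ω̄) ⊆ A_y[𝔞](Ω̄)` for the upstairs leg is recorded through `L`'s roof, so downstairs:
        (∀ 𝔞 : Ideal (𝓞 F), (∀ Pt ∈ L.1, IsIdealTorsionΩ S Kc 𝓜 w e I.univ I.act y 𝔞 Pt) →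
          (∀ Pt : (fibreΩOf S Kc 𝓜 w e I.univ y).Points (AlgebraicClosure (w.adicCompletion F)),
            (∀ r ∈ w.asIdeal * ((IsCMField.complexConj F) • w).asIdeal, (AlgPoints.map (actΩOf S Kc 𝓜 w e I.univ I.act r y).hom.hom.hom Pt :
              (fibreΩOf S Kc 𝓜 w e I.univ y).Points (AlgebraicClosure (w.adicCompletion F))) = 1) → IsIdealTorsionΩ S Kc 𝓜 w e I.univ I.act y 𝔞 Pt) →
          ∀ ⦃T : SchemeOver (geomResidueField w)⦄ (z : T ⟶ (sch₀Of 𝓜 w I.univ (red₀Of S Kc 𝓜 w h𝓨 e y)).X),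
            z ≫ ψ = 1 → ∀ r ∈ 𝔞, z ≫ (act₀Of 𝓜 w I.univ I.act r (red₀Of S Kc 𝓜 w h𝓨 e y)).hom.hom.hom = 1) ∧
        -- (RK) the rank of `Ker ψ`, BY VALUE for every closed realisation (LA2-p04 (g2) (C6′) `hrkᵢ` text)
        (∀ (K : SchemeOver (geomResidueField w)) [GrpObj K] [IsAffine K.left] [Module.Finite (geomResidueField w) (Alg K)]
          (κ : K ⟶ (sch₀Of 𝓜 w I.univ (red₀Of S Kc 𝓜 w h𝓨 e y)).X) [IsMonHom κ] [IsClosedImmersion κ.left],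
          (∀ ⦃T : SchemeOver (geomResidueField w)⦄ (t : T ⟶ (sch₀Of 𝓜 w I.univ (red₀Of S Kc 𝓜 w h𝓨 e y)).X), (∃ s : T ⟶ K, s ≫ κ = t) ↔ t ≫ ψ = 1) →
          Module.finrank (geomResidueField w) (Alg K) = I.pChar ^ I.fDeg * I.pChar ^ I.fDeg) ∧
        -- (KILL) `ψ` kills `V(spGeoOf y L) ↪ G₀(x̄) ↪ A_{x̄}`
        quotIncl (𝔡 (red₀Of S Kc 𝓜 w h𝓨 e y)).G₀ (spGeoOf I 𝔡 y L).1 ≫ (𝔡 (red₀Of S Kc 𝓜 w h𝓨 e y)).ι₀G ≫ ψ = 1 ∧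
        -- (DOCK) `Ker ψ ∩ G₀(x̄) = V(spGeoOf y L)` on all `T`-points of the dock
        (∀ ⦃T : SchemeOver (geomResidueField w)⦄ (t : T ⟶ (𝔡 (red₀Of S Kc 𝓜 w h𝓨 e y)).G₀),
          t ≫ (𝔡 (red₀Of S Kc 𝓜 w h𝓨 e y)).ι₀G ≫ ψ = 1 ↔
            ∃ s : T ⟶ specOver (geomResidueField w) (Alg (𝔡 (red₀Of S Kc 𝓜 w h𝓨 e y)).G₀ ⧸ (spGeoOf I 𝔡 y L).1),
              s ≫ quotIncl (𝔡 (red₀Of S Kc 𝓜 w h𝓨 e y)).G₀ (spGeoOf I 𝔡 y L).1 = t) ∧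
        -- (IMG) row, SHAPE (a) of record (LA2-plan (g2) 09:18:21Z (2)): the BACKTRACKING line `L_b` with `himg` (LA2-p03 (g3) f3424bb3 :279–:285 text at `H″ := spGeoOf I 𝔡 (quotΩ y L) L_b`)
        ∃ Lb : LineOf I (quotΩ y L), quotΩ (quotΩ y L) Lb = translΩ y ∧
          (letI := (𝔡 (red₀Of S Kc 𝓜 w h𝓨 e (quotΩ y L))).grp₀; haveI := (𝔡 (red₀Of S Kc 𝓜 w h𝓨 e (quotΩ y L))).aff₀;
            ∀ ⦃T : SchemeOver (geomResidueField w)⦄ (t : T ⟶ (𝔡 (red₀Of S Kc 𝓜 w h𝓨 e y)).G₀),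
              ∃ s : T ⟶ specOver (geomResidueField w) (Alg (𝔡 (red₀Of S Kc 𝓜 w h𝓨 e (quotΩ y L))).G₀ ⧸ (spGeoOf I 𝔡 (quotΩ y L) Lb).1),
                s ≫ quotIncl (𝔡 (red₀Of S Kc 𝓜 w h𝓨 e (quotΩ y L))).G₀ (spGeoOf I 𝔡 (quotΩ y L) Lb).1 ≫ (𝔡 (red₀Of S Kc 𝓜 w h𝓨 e (quotΩ y L))).ι₀G ≫
                    baseChangeHom (baseChangeHom (serreTranslate I.act E' hE' P) (pullback.fst (𝓜.localise w).total.hom (specResidueField w))) (red₀Of S Kc 𝓜 w h𝓨 e (quotΩ y L)).left =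
                  t ≫ (𝔡 (red₀Of S Kc 𝓜 w h𝓨 e y)).ι₀G ≫ ψ)
    := by
  -- §A.1: ④-bis at THIS roof's D-line rows (every argument is one of this theorem's own binders — syntactic)
  have H := exists_roofLeg_kerRowsFin_image_of_dlineLegs I E' hE' P Q _hP _hQ _hQP _hPQ _h𝔭 hD y (quotΩ y L) DB lamB hDBu q c
    hr2 hcsurj hr3q hr3c hr4 hr5
  have hA := rho1_rowsA_of_leg I quotΩ translΩ _hhecke _hroof _hroof₂ _hunit _hKc E' hE' P y L K _hKL hRoof q c _hr1 H.choose H.choose rfl H.choose_spec.fst H.choose_spec.snd.1 H.choose_spec.snd.2.1 H.choose_spec.snd.2.2.1 H.choose_spec.snd.2.2.2.1 H.choose_spec.snd.2.2.2.2.2.1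
  have hRK := rho1_rowRK_of_leg I quotΩ translΩ _hhecke _hroof _hroof₂ _hunit _hKc E' hE' y L K _hKL hRoof q _hr1 H.choose H.choose rfl H.choose_spec.snd.2.2.2.2.2.2.2.2.1
  have hKILL := rho1_rowKILL_of_leg I 𝔡 quotΩ E' hE' y L K _hKL q _hr1 H.choose H.choose rfl H.choose_spec.snd.2.2.2.2.1
  have hDOCK := rho1_rowDOCK_of_leg I 𝔡 quotΩ translΩ _hhecke _hroof _hroof₂ _hunit _hKc E' hE' y L K _hKL hRoof q _hr1 H.choose H.choose rfl H.choose_spec.fst H.choose_spec.snd.2.1 H.choose_spec.snd.2.2.2.2.1 H.choose_spec.snd.2.2.2.2.2.1 H.choose_spec.snd.2.2.2.2.2.2.2.1 H.choose_spec.snd.2.2.2.2.2.2.2.2.1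
  have hIMG := rho1_rowIMG_of_leg I 𝔡 quotΩ translΩ _hhecke _hroof _hroof₂ _hunit _hKc E' hE' P Q _hP _hQ _hQP _hPQ _h𝔭 y L K _hKL DB lamB hDBu q c _hr1 hr2 hcsurj hr3q hr3c hr4 hr5 H.choose H.choose rfl H.choose_spec.snd.2.2.2.2.2.2.2.2.2
  exact ⟨H.choose, hA.fst, hA.snd.1, hA.snd.2.1, hA.snd.2.2.1, hA.snd.2.2.2.1, hA.snd.2.2.2.2, hRK, hKILL, hDOCK, hIMG⟩

end Rho1Head

end Summit.HodgeConjecture.HodgeConjecture.Cruxes.HLiu418.F0P6aLineSpecialisation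

end
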